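import Mathlib
import Summits.Ventures.LatticeQCDFlow.Scaling.EntropyBudget
import Summits.Ventures.LatticeQCDFlow.Scaling.FreeEnergyBudget

/-!
# LatticeQCDFlow / Scaling — barrier supplement v2.0: the entropy-budget law (coupling × volume)

HONEST FRAMING: exact (Metropolis-corrected) sampling algorithms for lattice gauge theory;
figures of merit are autocorrelation/cost numbers at stated couplings and volumes; no
continuum-physics claim.

THEORY-2.md §5.10 (theory seat GEN-9).  Two PROVED supplements to the T4 entry
`ExactnessVsExpressivity` (THEORY-2.md §5.3) and to `ConcentrationBudget` (§5.5), in the docstring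
format of `Scaling/Barriers.lean` (`technique_class` · `blocks` · `because` · `evasions_known` ·
`scope_caveats` · `status`), each a `def … : Prop` immediately DISCHARGED by a theorem of
`Scaling/EntropyBudget.lean` / `Scaling/FreeEnergyBudget.lean`.  They replace the half-mass /
Laplace form of the coupling law (ConcentrationBudget + hypothesis (Gβ)) by an ENTROPY form whose
target-side input is a free energy — a printed THEOREM for `U(N)` (Chatterjee, J. Funct. Anal. 271
(2016) 2944 = arXiv:1602.01222, Thm 2.1; constant `K_d`: Brennecke arXiv:2511.07297 Thm 2) and an
elementary two-sided bound for `U(1)` / `SU(N)` (THEORY-2.md §3.2 v2.0, paper proofs) — instead of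
an untyped Laplace asymptotic.  The barrier NAMES of record (VolumeScalingOfTraining,
TopologicalModeCollapse, ExactnessVsExpressivity, FermionDeterminantCost) are unchanged.
-/

namespace Summit.Ventures.LatticeQCDFlow.Barriers

open Finset

/-- **Supplement (EntropyBudgetLaw) to ExactnessVsExpressivity / ConcentrationBudget — the
coupling law in entropy form.**  For a flow model `q = T_*ν` (prior `ν` of density `≤ M` relative
to the reference `η`, volume distortion `η∘T⁻¹ ≤ J·η`) reweighted against the tilted target
`p_β = η·e^{−βS}/Z(β)`, and any `β₁ ≤ β` (`0 ≤ β`):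
`β₁·log Z(β) − β·log Z(β₁) ≤ (β − β₁)·(log M + log J − log ESS(p_β, q))`,
i.e. `log M + log J ≥ D_lower(β, β₁) − log(1/ESS)` with
`D_lower = (β₁ log Z(β) − β log Z(β₁))/(β − β₁) ≤ D(p_β‖η)` (two-free-energies bound).  On the
lattice (`η` = product Haar, `S` = Wilson action, `β₁ = β/2`):
`D(p_β‖Haar) ≥ log Z_Λ(β) − 2 log Z_Λ(β/2) = (n_tr/2)(1 − O(1/L))·log β − O(V)`, so an ESS `≥ ε`
REQUIRES log-Jacobian capacity `log J ≥ (n_tr/2)(1 − O(1/L))·log β − O(V) − log M − log(1/ε)`: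
extensive in the volume, logarithmic in the coupling (`n_tr = dim G·(d−1)·L^d`).
technique_class: deterministic flows (any architecture, any depth) from the Haar / strong-coupling
  prior or from a heat-bath prior at `β₀ < β` (then `log M` is replaced by the prior's own entropy
  deficit, see `MeanContractionLaw`), with exact reweighting or IMH.
blocks: β-uniform ESS / acceptance claims at fixed total log-Jacobian capacity; architectures with
  clamped per-layer log-det (`|s| ≤ s_max` affine couplings, Lipschitz-regularised layers): depth
  `× (updated dofs per layer) × s_max ≥ (n_tr/2)(1 − O(1/L))·log β − O(V)`.
because: PROVED `Theory2.entropyBudget` (= `Theory2.klFin_add_log_essFrac_le` ∘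
  `Theory2.klFin_tiltLaw_ge`); lattice free energies (NOT part of this `def`): `U(N)` leading term
  `log Z = −(N²·abs(E¹)/2)·log β + O(V)` [Chatterjee 2016, Thm 2.1] (printed THEOREM, free box);
  over the tree's Wilson measure, any compact second-countable `G`: plaquette peeling
  `log Z_Λ(β) ≤ (d−1)L^{d−1}(L−1)·log Z₁(β)` PROVED (`Theory2.Lattice.peelingBound`,
  `Scaling/LatticePeeling.lean`), Gibbs identity + two free energies PROVED
  (`Theory2.Lattice.gibbsIdentity`, `twoFreeEnergies`, `Scaling/LatticeGibbs.lean`), and the CRUDE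
  two-sided law `κV((d−2)/2 − (d−1)/L)·log β − CV ≤ D(μ_{Λ,β}‖Haar^{⊗E}) ≤ κ(dV/2)·log β + CV`
  modulo the one-plaquette inputs `Z₁(β) ≤ Aβ^{−κ/2}`, `Haar(B_ε) ≥ aε^κ` PROVED
  (`Theory2.Lattice.crudeEntropyGrowth`, `Scaling/LatticeEntropyGrowth.lean`; same landing guide);
  the sharp `n_tr/2` coefficient (tree gauge) is a paper proof (THEORY-2.md §3.2 v2.0).
evasions_known: (i) heat-bath / HMC-thermalised prior at nearby `β₀` (capacity
  `(n_tr/2)·log(β/β₀) + O(V)`: β-ladders, annealed and stochastic flows)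
  [cite: BonannoEtAl2026, §4], [cite: BulgarelliCelliniNada2025, §4.2]; (ii) unboundedly
  contracting layers (spline / spectral flows) pay the
  capacity in few layers — the law constrains the TOTAL log-Jacobian, the depth only under a
  per-layer cap (arXiv:2102.06539, Prop. 1).
scope_caveats: necessary, not sufficient (paying the capacity certifies nothing: T2-A / T2-I still
  price every defect); the `O(V)` constants of the elementary `U(1)`/`SU(N)` bounds are crude (the
  sharp constant is printed for `U(N)` on the free box only); at today's couplings (`SU(3)`,
  `β = 6` ⇔ Chatterjee's `β_C = β/N = 2`) the per-dof budget is `O(1)` nats — the law is the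
  continuum-limit (`log β`) statement, extensive at every β.  One `U(1)` plaquette:
  `e^{−D(p_β‖Haar)}` over-estimates the true `ESS(p_β, Haar) = I₀(β)²/I₀(2β)` by a factor `≤ 1.23`
  for `1 ≤ β ≤ 128` (`→ √(e/2) = 1.166`), against `3.6` for the optimised-event form of
  ConcentrationBudget.
status: PROVED finite law (`entropyBudgetLaw`) + lattice input PROVED in Lean up to the
  one-plaquette asymptotics and the tree gauge
  (`Scaling/Lattice{Entropy,Peeling,Gibbs,EntropyGrowth}.lean`); the sharp coefficient and the
  `U(1)`/`SU(N)` one-plaquette instances = THEORY-2.md row R-T2-10; `U(N)` free-box constant =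
  printed THEOREM. -/
def EntropyBudgetLaw : Prop :=
  ∀ (X : Type) [Fintype X] [Nonempty X] (T : X ≃ X) (ν η S : X → ℝ) (β β₁ M J : ℝ),
    (∀ x, 0 < ν x) → (∀ x, 0 < η x) → 0 ≤ β → β₁ ≤ β →
    (∀ x, ν x ≤ M * η x) → (∀ y, η (T.symm y) ≤ J * η y) →
    β₁ * Real.log (Theory2.tiltZ η S β) - β * Real.log (Theory2.tiltZ η S β₁) ≤
      (β - β₁) * (Real.log M + Real.log J -
        Real.log (Theory2.essFrac (Theory2.tiltLaw η S β) (Theory2.pushLaw T ν)))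

/-- Discharge of `EntropyBudgetLaw` by `Theory2.entropyBudget`. -/
theorem entropyBudgetLaw : EntropyBudgetLaw :=
  fun _ _ _ T _ _ S _ _ _ _ hν hη hβ0 hβ hM hJ => Theory2.entropyBudget T hν hη S hβ0 hβ hM hJ

/-- **Supplement (MeanContractionLaw) to ExactnessVsExpressivity — the coupling law where the
target lives, with a general (e.g. heat-bath) prior.**  For a flow model `q = T_*ν` from ANY
positive normalised prior `ν` and any positive target `p` (reference `η`):
`E_p[logJac_T] ≥ D(p‖η) − D(ν‖η) − log(1/ESS) − √((1/ESS − 1)·Var_ν(log ν/η))`,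
where `logJac_T(y) = log(η(T⁻¹y)/η(y))` is the log-volume contraction of the flow at `y` and
`ESS = ESS(p, q)`.  Reading: the MEAN log-contraction of the flow over target-typical configurations
must make up the difference of the entropy deficits of target and prior — on the lattice
`(n_tr/2)(1 − O(1/L))·log(β/β₀) − O(V)` for a heat-bath prior at `β₀` — up to `log(1/ESS)` and a
fluctuation term `√(χ²·Var_ν(β₀S))` (`χ² = 1/ESS − 1`, `Var = O(V)`), which is sub-leading exactly
when the ESS is not exponentially small.  This is the measurable form: `E_p[logJac_T]` is the flow's
mean log-det over (inverse images of) reference HMC configurations.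
technique_class: as `EntropyBudgetLaw`, including heat-bath / thermalised priors and β-ladders
  (apply per rung).
blocks: capacity accounting by the prior's sup-density `M` when the prior is itself concentrated
  (heat-bath prior: `log M = Θ(V log β₀)` is the wrong currency; the entropy deficit `D(ν‖η)` is the
  right one); "the flow only needs to be close to the identity at nearby couplings" without a
  log-det budget `∝ n_tr·log(β/β₀)`.
because: PROVED `Theory2.sum_logJac_ge'` (= bookkeeping identity `Theory2.klFin_ref_eq` +
  `D(p‖q) ≤ log(1/ESS)` + the χ²–variance inequality `Theory2.sub_sq_le_chiSq_mul_varLaw`).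
evasions_known: none needed — it is an accounting identity with two dropped non-negative terms;
  routes "evade" it only by paying it (more contracting layers per rung, smaller `β/β₀` per rung:
  `n_rungs × capacity per rung ≥ (n_tr/2)·log(β/β₀)` in total either way).
scope_caveats: necessary, not sufficient; the fluctuation term makes it vacuous when
  `ESS ≤ e^{−Θ(V)}` (then nothing is claimed, correctly); `Var_ν(log ν/η)` for a heat-bath prior is
  the action variance `β₀²·Var_{β₀}(S) = Θ(V)` (specific heat), finite at every β₀.
status: PROVED (`meanContractionLaw`). -/
def MeanContractionLaw : Prop :=
  ∀ (X : Type) [Fintype X] (T : X ≃ X) (p ν η : X → ℝ),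
    (∀ x, 0 < p x) → ∑ x, p x = 1 → (∀ x, 0 < ν x) → ∑ x, ν x = 1 → (∀ x, 0 < η x) →
    Theory2.klFin p η - Theory2.klFin ν η + Real.log (Theory2.essFrac p (Theory2.pushLaw T ν))
      - Real.sqrt (((Theory2.essFrac p (Theory2.pushLaw T ν))⁻¹ - 1) *
          Theory2.varLaw ν (Theory2.logW ν η))
      ≤ ∑ y, p y * Theory2.logJac T η y

/-- Discharge of `MeanContractionLaw` by `Theory2.sum_logJac_ge'`. -/
theorem meanContractionLaw : MeanContractionLaw :=
  fun _ _ T _ _ _ hp hp1 hν hν1 hη => Theory2.sum_logJac_ge' T hp hp1 hν hν1 hη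

end Summit.Ventures.LatticeQCDFlow.Barriers
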